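import Mathlib.RingTheory.Henselian
import Mathlib.LinearAlgebra.Prod
import Mathlib.Algebra.Module.Submodule.Ker
import Mathlib.Algebra.Module.Submodule.Range
import Mathlib.Tactic.LinearCombination
import Mathlib.Tactic.Module
import Mathlib.Tactic.ComputeDegree
import HarnessLib

/-!
# THE `U_p`-NILPOTENT PROJECTOR IS A POLYNOMIAL IN `U_p`: Hensel's idempotent of Proposition V64-B DISCHARGED, checkpoint (i) WITHOUT Nakayama, and the decomposition `Y = Y^{nil} ⊕ Y^{u}` (cell `b2b-bsdres`, seat additive-p4 gen 39, line V68 — K118)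

HONEST FRAMING (verbatim, cell `b2b-bsdres`): the goal of the cell is to DELETE the COMBINATION-SHAPED
residual classes for ALL analytic-rank `≤ 1` curves over `ℚ` — "full BSD formula for every rank `≤ 1`
curve in class `C`" assembled STRICTLY from published theorems — so that the rank-`≤ 1` remainder
becomes exactly the CONSTRUCTION-SHAPED classes, which are TYPED (missing-input Props), NOT attempted;
this is not "finishing BSD". This file: TOOL theorems (pure module algebra; 0 defs, 0 facts, nothing
booked; X4 stays CONSTRUCTION-shaped).

## What is proved

Setting of `X4/UpNilpotentPartOfSemistableLevel.lean` (K114): `R` a commutative ring (`𝕋(M)_𝔪`), `K`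
(`= H_{M,𝔪}`, the `p`-minimal level) and `Y` (`= H_{pM,𝔪}`, the semistable level) `R`-modules,
`j′ = d₁.coprod dₚ : K × K → Y` the `p`-old pair, `U : Y → Y` (`= U_p`) with convention (A)
`U (d₁ x) = d₁ (t • x) − p • dₚ x`, `U (dₚ x) = d₁ x`, and `hAL : U (U y) − y ∈ range j′`
(`U_p² = 1` on the `p`-new quotient: `U_p = ∓W_p` on `p`-new forms). K114's headline
`upNilpotentPart_eq_range_intertwiner` took HENSEL'S IDEMPOTENT `e` of the `U_p`-nilpotent part as FIVE
displayed hypotheses (`he`, `heU`, `he₀`, `he₁`, `hnil`) plus finiteness of `Y` and an ideal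
`I ≤ Jac(R)` (Nakayama). Here all of that is DISCHARGED from the two roots `u₀, u₁` of `X² − tX + p`:

* `quadratic_apply_coprod` — `U² − tU + p = 0` on the `p`-old part `range j′` (from convention (A));
* `roots_sum_eq` / `roots_prod_eq` — Vieta from the two root relations and `u₁ − u₀ ∈ Rˣ`;
* `U_cubic_apply` — **`(U − u₀)(U − u₁)(U² − 1) = 0` on all of `Y`** (from `hAL` and the quadratic
  relation): `U_p` on `H_{pM,𝔪}` is annihilated by an explicit quartic with roots `u₀, u₁, 1, −1`;
* `projector_*` — for `c` with `c · (u₀ − u₁)(u₀² − 1) = 1` (i.e. `u₁ − u₀` AND `u₀² − 1` units — the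
  latter automatic when `u₀ ∈ 𝔪`), the endomorphism **`e₀ := c • ((U − u₁) ∘ (U² − 1))`** — a POLYNOMIAL
  in `U` — is an idempotent commuting with `U`, with `Fix(e₀) = ker(U − u₀)`, `U ∘ e₀ = u₀ • e₀`
  (so `hnil` holds with `n = 1` for any ideal `I ∋ u₀`), `e₀ = 1` on `φ₀(K)` and `e₀ = 0` on `φ₁(K)`:
  the five `e`-hypotheses of K114 hold for `e₀` (assembled as `K114_hypotheses_of_projector` in the
  companion file `X4/UpNilpotentPartOfRoots.lean`, which imports K114);
* `ker_sub_le_range_coprod` — **checkpoint (i) without Nakayama**: `ker(U − u₀) ≤ range j′` because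
  `(U² − 1) y = (u₀² − 1) • y` there and `u₀² − 1` is a unit — no finiteness, no Jacobson radical;
* `isCompl_ker_sub_ker_cubic` — **`Y = Y^{nil} ⊕ Y^{u}`**: `ker(U − u₀)` and `ker((U − u₁)(U² − 1))`
  are complementary (the splitting that turns T-V54 at `(pM, 𝔪)` into the conjunction of T-V54 on the
  nilpotent part and T-V54 at the ordinary ideals — memo V64 §3 (B2), last display);
* (companion file `X4/UpNilpotentPartOfRoots.lean`) `upNilpotentPart_eq_range_intertwiner_of_roots` —
  PROPOSITION V64-B (B2) with Hensel's idempotent discharged: for `N := ker(U − u₀ • 1)`: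
  `N = range φ₀` (`φ₀ = d₁ + (u₀ − t) • dₚ`, injective), `U = u₀` on `N`, the saturation transfer
  `K ↔ N`, AND the complement clause — hypotheses: convention (A), the two roots with `u₁ − u₀`,
  `u₀² − 1` units, `hj` (Ihara at `p ∤ M`, BY NAME), `hAL`; NO finiteness, NO idempotent, NO ideal
  (this file is Mathlib-only; the companion needs K114's `eigen_iff_mem_range_intertwiner`);
* `exists_roots_of_henselian` — where the roots come from: over a HENSELIAN local ring (e.g. the
  complete local ring `𝕋(M)_𝔪`), if `p ∈ 𝔪` and `t = T_p` is a unit (the ORDINARY case `a_p(ρ̄) ≠ 0` of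
  memo V64 §3 (B2)), `X² − tX + p` has roots `u₀ ∈ 𝔪`, `u₁ = t − u₀` with `u₁ − u₀` and `u₀² − 1` units
  (Mathlib's `HenselianLocalRing.is_henselian` at `a₀ = 0`).

So in the END-STATE display (memo V66 §4 (a′)) the input "Hensel in `𝕋(M)_𝔪[U₃]`" of Prop. V64-B
shrinks to the Henselian property of the coefficient ring (a structural fact about complete local
rings, Mathlib-level), and REFEREE 2's checkpoint (i) ("nilpotent ⊆ `p`-old needs `U_p` invertible on
the `p`-new part") is now the one-line unit argument `ker_sub_le_range_coprod`.

## References (context only; the proofs are elementary)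

* A. Wiles, Ann. of Math. 141 (1995), §2 (the `p`-old pair and `U_p`). [cite: Wiles1995, §2]
* K. Ribet, Proc. ICM 1983 (1984), Thm. 4.1 (Ihara's lemma, BY NAME). [cite: Ribet1984ICM, Thm. 4.1]
-/

namespace Summit.BirchSwinnertonDyer.Rank1Residual.LevelLowering

section Roots

variable {R : Type*} [CommRing R]

/-- **Vieta, sum**: two roots `u₀, u₁` of `X² − tX + p` with `u₁ − u₀` a unit have `u₀ + u₁ = t`. -/
theorem roots_sum_eq (t p u₀ u₁ : R) (hu₀ : u₀ * u₀ = t * u₀ - p) (hu₁ : u₁ * u₁ = t * u₁ - p)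
    (hunit : IsUnit (u₁ - u₀)) : u₀ + u₁ = t := by
  have h : (u₁ - u₀) * (u₀ + u₁ - t) = 0 := by linear_combination hu₁ - hu₀
  have h0 : u₀ + u₁ - t = 0 := hunit.mul_right_eq_zero.mp h
  linear_combination h0

/-- **Vieta, product**: `u₀ · u₁ = p`. -/
theorem roots_prod_eq (t p u₀ u₁ : R) (hu₀ : u₀ * u₀ = t * u₀ - p) (hu₁ : u₁ * u₁ = t * u₁ - p)
    (hunit : IsUnit (u₁ - u₀)) : u₀ * u₁ = p := by
  have hs := roots_sum_eq t p u₀ u₁ hu₀ hu₁ hunit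
  linear_combination u₀ * hs - hu₀

open Polynomial in
/-- **Where the roots come from (Hensel).** Over a Henselian local ring `R` (e.g. a complete Noetherian
local ring such as `𝕋(M)_𝔪`), if `p ∈ 𝔪` and `t` is a unit (the ordinary case `a_p(ρ̄) ≠ 0`), the
quadratic `X² − tX + p` has a root `u₀ ∈ 𝔪` and a root `u₁ = t − u₀` with `u₁ − u₀` and `u₀² − 1`
units — exactly the root data consumed below and by K114. [cite: Wiles1995, §2] -/
theorem exists_roots_of_henselian [HenselianLocalRing R] (t p : R)
    (hp : p ∈ IsLocalRing.maximalIdeal R) (ht : IsUnit t) :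
    ∃ u₀ u₁ : R, u₀ * u₀ = t * u₀ - p ∧ u₁ * u₁ = t * u₁ - p ∧ IsUnit (u₁ - u₀)
      ∧ IsUnit (u₀ * u₀ - 1) ∧ u₀ ∈ IsLocalRing.maximalIdeal R := by
  have hmonic : (X ^ 2 - C t * X + C p : R[X]).Monic := by monicity!
  have h1 : (X ^ 2 - C t * X + C p : R[X]).eval 0 ∈ IsLocalRing.maximalIdeal R := by
    simpa using hp
  have h2 : IsUnit ((derivative (X ^ 2 - C t * X + C p : R[X])).eval 0) := by
    have : (derivative (X ^ 2 - C t * X + C p : R[X])).eval 0 = -t := by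
      simp [derivative_mul]
    rw [this]
    exact ht.neg
  obtain ⟨a, ha, ha0⟩ := HenselianLocalRing.is_henselian _ hmonic 0 h1 h2
  rw [sub_zero] at ha0
  have hroot : a * a = t * a - p := by
    have := ha.eq_zero
    simp only [eval_add, eval_sub, eval_mul, eval_pow, eval_C, eval_X] at this
    linear_combination this
  refine ⟨a, t - a, hroot, by linear_combination hroot, ?_, ?_, ha0⟩
  · -- t − 2a ∉ 𝔪 since t ∉ 𝔪 and 2a ∈ 𝔪
    rw [← IsLocalRing.notMem_maximalIdeal]
    intro h
    have ht' : t ∈ IsLocalRing.maximalIdeal R := by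
      have : t = (t - a - a) + 2 * a := by ring
      rw [this]
      exact Ideal.add_mem _ h (Ideal.mul_mem_left _ 2 ha0)
    exact (IsLocalRing.notMem_maximalIdeal.mpr ht) ht'
  · have hu : IsUnit (1 - a * a) :=
      IsLocalRing.isUnit_one_sub_self_of_mem_nonunits (a * a)
        ((IsLocalRing.mem_maximalIdeal _).mp (Ideal.mul_mem_left _ a ha0))
    rw [← neg_sub]
    exact hu.neg

end Roots

section Annihilator

variable {R K Y : Type*} [CommRing R] [AddCommGroup K] [Module R K] [AddCommGroup Y] [Module R Y]

/-- **`U² − tU + p = 0` on the `p`-old part** (from convention (A): `U_p` acts on `j′(K × K)` through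
the companion operator of `X² − tX + p`). [cite: Wiles1995, §2] -/
theorem quadratic_apply_coprod (t p : R) (d₁ dₚ : K →ₗ[R] Y) (U : Y →ₗ[R] Y)
    (hU₁ : ∀ x, U (d₁ x) = d₁ (t • x) - p • dₚ x) (hUₚ : ∀ x, U (dₚ x) = d₁ x) (w : K × K) :
    U (U (d₁.coprod dₚ w)) - t • U (d₁.coprod dₚ w) + p • d₁.coprod dₚ w = 0 := by
  obtain ⟨x, y⟩ := w
  simp only [LinearMap.coprod_apply, map_add, map_sub, map_smul, hU₁, hUₚ]
  module

/-- The cubic `(U − u₁)(U² − 1)` applied. -/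
theorem cubic_apply (u₁ : R) (U : Y →ₗ[R] Y) (y : Y) :
    ((U - u₁ • 1) * (U * U - 1)) y = U (U (U y) - y) - u₁ • (U (U y) - y) := by
  simp only [Module.End.mul_apply, LinearMap.sub_apply, LinearMap.smul_apply, Module.End.one_apply]

/-- On a `u`-eigenvector the cubic `(U − u₁)(U² − 1)` acts by the scalar `(u − u₁)(u² − 1)`. -/
theorem cubic_apply_of_eigen (u u₁ : R) (U : Y →ₗ[R] Y) (y : Y) (hy : U y = u • y) :
    ((U - u₁ • 1) * (U * U - 1)) y = ((u - u₁) * (u * u - 1)) • y := by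
  rw [cubic_apply]
  simp only [map_sub, map_smul, hy]
  module

/-- **THE QUARTIC ANNIHILATES `U`**: `(U − u₀)((U − u₁)(U² − 1) y) = 0` for every `y ∈ Y`, i.e. the
image of the cubic `(U − u₁)(U² − 1)` consists of `u₀`-eigenvectors. Inputs: convention (A), the two
roots (`u₁ − u₀` a unit, for Vieta) and `hAL : U (U y) − y ∈ range j′`. [cite: Wiles1995, §2] -/
theorem U_cubic_apply (t p u₀ u₁ : R) (hu₀ : u₀ * u₀ = t * u₀ - p) (hu₁ : u₁ * u₁ = t * u₁ - p)
    (hunit : IsUnit (u₁ - u₀)) (d₁ dₚ : K →ₗ[R] Y) (U : Y →ₗ[R] Y)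
    (hU₁ : ∀ x, U (d₁ x) = d₁ (t • x) - p • dₚ x) (hUₚ : ∀ x, U (dₚ x) = d₁ x)
    (hAL : ∀ y, U (U y) - y ∈ LinearMap.range (d₁.coprod dₚ)) (y : Y) :
    U (((U - u₁ • 1) * (U * U - 1)) y) = u₀ • ((U - u₁ • 1) * (U * U - 1)) y := by
  obtain ⟨w, hw⟩ := hAL y
  have hq := quadratic_apply_coprod t p d₁ dₚ U hU₁ hUₚ w
  rw [hw] at hq
  have hs : t = u₀ + u₁ := (roots_sum_eq t p u₀ u₁ hu₀ hu₁ hunit).symm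
  have hpr : p = u₀ * u₁ := (roots_prod_eq t p u₀ u₁ hu₀ hu₁ hunit).symm
  rw [hs, hpr] at hq
  rw [cubic_apply]
  simp only [map_sub, map_smul] at hq ⊢
  linear_combination (norm := module) hq

/-- `U ∘ e₀ = u₀ • e₀` for `e₀ := c • (U − u₁)(U² − 1)`. -/
theorem U_projector_apply (t p u₀ u₁ : R) (hu₀ : u₀ * u₀ = t * u₀ - p) (hu₁ : u₁ * u₁ = t * u₁ - p)
    (hunit : IsUnit (u₁ - u₀)) (d₁ dₚ : K →ₗ[R] Y) (U : Y →ₗ[R] Y)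
    (hU₁ : ∀ x, U (d₁ x) = d₁ (t • x) - p • dₚ x) (hUₚ : ∀ x, U (dₚ x) = d₁ x)
    (hAL : ∀ y, U (U y) - y ∈ LinearMap.range (d₁.coprod dₚ)) (c : R) (y : Y) :
    U ((c • ((U - u₁ • 1) * (U * U - 1))) y) = u₀ • (c • ((U - u₁ • 1) * (U * U - 1))) y := by
  rw [LinearMap.smul_apply, map_smul, U_cubic_apply t p u₀ u₁ hu₀ hu₁ hunit d₁ dₚ U hU₁ hUₚ hAL y,
    smul_comm]

/-- **`e₀` commutes with `U`** (it is a polynomial in `U`). -/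
theorem projector_comm (u₁ c : R) (U : Y →ₗ[R] Y) (y : Y) :
    (c • ((U - u₁ • 1) * (U * U - 1))) (U y) = U ((c • ((U - u₁ • 1) * (U * U - 1))) y) := by
  simp only [LinearMap.smul_apply, cubic_apply, map_sub, map_smul]

/-- **`e₀` is an idempotent** when `c · (u₀ − u₁)(u₀² − 1) = 1`. -/
theorem projector_idem (t p u₀ u₁ : R) (hu₀ : u₀ * u₀ = t * u₀ - p) (hu₁ : u₁ * u₁ = t * u₁ - p)
    (hunit : IsUnit (u₁ - u₀)) (d₁ dₚ : K →ₗ[R] Y) (U : Y →ₗ[R] Y)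
    (hU₁ : ∀ x, U (d₁ x) = d₁ (t • x) - p • dₚ x) (hUₚ : ∀ x, U (dₚ x) = d₁ x)
    (hAL : ∀ y, U (U y) - y ∈ LinearMap.range (d₁.coprod dₚ))
    (c : R) (hc : c * ((u₀ - u₁) * (u₀ * u₀ - 1)) = 1) (y : Y) :
    (c • ((U - u₁ • 1) * (U * U - 1))) ((c • ((U - u₁ • 1) * (U * U - 1))) y)
      = (c • ((U - u₁ • 1) * (U * U - 1))) y := by
  have heig := U_cubic_apply t p u₀ u₁ hu₀ hu₁ hunit d₁ dₚ U hU₁ hUₚ hAL y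
  rw [LinearMap.smul_apply, LinearMap.smul_apply, map_smul,
    cubic_apply_of_eigen u₀ u₁ U _ heig, smul_smul, smul_smul]
  congr 1
  rw [mul_assoc, hc, mul_one]

/-- **`Fix(e₀) = ker(U − u₀)`**: `e₀ y = y ↔ U y = u₀ • y`. -/
theorem projector_apply_eq_self_iff (t p u₀ u₁ : R) (hu₀ : u₀ * u₀ = t * u₀ - p)
    (hu₁ : u₁ * u₁ = t * u₁ - p) (hunit : IsUnit (u₁ - u₀)) (d₁ dₚ : K →ₗ[R] Y) (U : Y →ₗ[R] Y)
    (hU₁ : ∀ x, U (d₁ x) = d₁ (t • x) - p • dₚ x) (hUₚ : ∀ x, U (dₚ x) = d₁ x)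
    (hAL : ∀ y, U (U y) - y ∈ LinearMap.range (d₁.coprod dₚ))
    (c : R) (hc : c * ((u₀ - u₁) * (u₀ * u₀ - 1)) = 1) (y : Y) :
    (c • ((U - u₁ • 1) * (U * U - 1))) y = y ↔ U y = u₀ • y := by
  constructor
  · intro h
    calc U y = U ((c • ((U - u₁ • 1) * (U * U - 1))) y) := by rw [h]
      _ = u₀ • (c • ((U - u₁ • 1) * (U * U - 1))) y :=
          U_projector_apply t p u₀ u₁ hu₀ hu₁ hunit d₁ dₚ U hU₁ hUₚ hAL c y
      _ = u₀ • y := by rw [h]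
  · intro h
    rw [LinearMap.smul_apply, cubic_apply_of_eigen u₀ u₁ U y h, smul_smul, hc, one_smul]

/-- **`e₀ = 1` on `φ₀(K)`** (`φ₀ = d₁ + (u₀ − t) • dₚ` is `u₀`-eigen: K114's `U_intertwiner_apply`). -/
theorem projector_apply_intertwiner₀ (t p u₀ u₁ : R) (hu₀ : u₀ * u₀ = t * u₀ - p)
    (hu₁ : u₁ * u₁ = t * u₁ - p) (hunit : IsUnit (u₁ - u₀)) (d₁ dₚ : K →ₗ[R] Y) (U : Y →ₗ[R] Y)
    (hU₁ : ∀ x, U (d₁ x) = d₁ (t • x) - p • dₚ x) (hUₚ : ∀ x, U (dₚ x) = d₁ x)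
    (hAL : ∀ y, U (U y) - y ∈ LinearMap.range (d₁.coprod dₚ))
    (c : R) (hc : c * ((u₀ - u₁) * (u₀ * u₀ - 1)) = 1) (x : K) :
    (c • ((U - u₁ • 1) * (U * U - 1))) ((d₁ + (u₀ - t) • dₚ) x) = (d₁ + (u₀ - t) • dₚ) x := by
  -- `φ₀ x` is a `u₀`-eigenvector (K114's `U_intertwiner_apply`, recomputed inline)
  have h : U ((d₁ + (u₀ - t) • dₚ) x) = u₀ • (d₁ + (u₀ - t) • dₚ) x := by
    have hp : p = t * u₀ - u₀ * u₀ := by rw [hu₀]; ring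
    subst hp
    simp only [LinearMap.add_apply, LinearMap.smul_apply, map_add, map_smul, hU₁, hUₚ]
    module
  exact (projector_apply_eq_self_iff t _ u₀ u₁ hu₀ hu₁ hunit d₁ dₚ U hU₁ hUₚ hAL c hc _).mpr h

/-- **`e₀ = 0` on `φ₁(K)`** (`φ₁ = d₁ + (u₁ − t) • dₚ` is `u₁`-eigen and `u₁` is a root of the cubic). -/
theorem projector_apply_intertwiner₁ (t p u₁ : R) (hu₁ : u₁ * u₁ = t * u₁ - p)
    (d₁ dₚ : K →ₗ[R] Y) (U : Y →ₗ[R] Y)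
    (hU₁ : ∀ x, U (d₁ x) = d₁ (t • x) - p • dₚ x) (hUₚ : ∀ x, U (dₚ x) = d₁ x) (c : R) (x : K) :
    (c • ((U - u₁ • 1) * (U * U - 1))) ((d₁ + (u₁ - t) • dₚ) x) = 0 := by
  -- `φ₁ x` is a `u₁`-eigenvector (K114's `U_intertwiner_apply` with `u₁`, recomputed inline)
  have h : U ((d₁ + (u₁ - t) • dₚ) x) = u₁ • (d₁ + (u₁ - t) • dₚ) x := by
    have hp : p = t * u₁ - u₁ * u₁ := by rw [hu₁]; ring
    subst hp
    simp only [LinearMap.add_apply, LinearMap.smul_apply, map_add, map_smul, hU₁, hUₚ]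
    module
  rw [LinearMap.smul_apply, cubic_apply_of_eigen u₁ u₁ U _ h, sub_self, zero_mul, zero_smul,
    smul_zero]

/-- The complement: `(U − u₁)(U² − 1)` kills `y − e₀ y`. -/
theorem cubic_apply_sub_projector (t p u₀ u₁ : R) (hu₀ : u₀ * u₀ = t * u₀ - p)
    (hu₁ : u₁ * u₁ = t * u₁ - p) (hunit : IsUnit (u₁ - u₀)) (d₁ dₚ : K →ₗ[R] Y) (U : Y →ₗ[R] Y)
    (hU₁ : ∀ x, U (d₁ x) = d₁ (t • x) - p • dₚ x) (hUₚ : ∀ x, U (dₚ x) = d₁ x)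
    (hAL : ∀ y, U (U y) - y ∈ LinearMap.range (d₁.coprod dₚ))
    (c : R) (hc : c * ((u₀ - u₁) * (u₀ * u₀ - 1)) = 1) (y : Y) :
    ((U - u₁ • 1) * (U * U - 1)) (y - (c • ((U - u₁ • 1) * (U * U - 1))) y) = 0 := by
  have heig := U_cubic_apply t p u₀ u₁ hu₀ hu₁ hunit d₁ dₚ U hU₁ hUₚ hAL y
  rw [map_sub, LinearMap.smul_apply, map_smul, cubic_apply_of_eigen u₀ u₁ U _ heig, smul_smul, hc,
    one_smul, sub_self]

/-- **`Y = Y^{nil} ⊕ Y^{u}`**: `ker(U − u₀)` (the `U_p`-nilpotent part, `u₀ ∈ 𝔪`) and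
`ker((U − u₁)(U² − 1))` (the unit-root part: `u₁` and `±1`) are complementary submodules — the
splitting of memo V64 §3 (B2) that makes T-V54 at `(pM, 𝔪)` the conjunction of T-V54 on the nilpotent
part and T-V54 at the ordinary ideals. [cite: Wiles1995, §2] -/
theorem isCompl_ker_sub_ker_cubic (t p u₀ u₁ : R) (hu₀ : u₀ * u₀ = t * u₀ - p)
    (hu₁ : u₁ * u₁ = t * u₁ - p) (hunit : IsUnit (u₁ - u₀)) (d₁ dₚ : K →ₗ[R] Y) (U : Y →ₗ[R] Y)
    (hU₁ : ∀ x, U (d₁ x) = d₁ (t • x) - p • dₚ x) (hUₚ : ∀ x, U (dₚ x) = d₁ x)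
    (hAL : ∀ y, U (U y) - y ∈ LinearMap.range (d₁.coprod dₚ))
    (c : R) (hc : c * ((u₀ - u₁) * (u₀ * u₀ - 1)) = 1) :
    IsCompl (LinearMap.ker (U - u₀ • 1)) (LinearMap.ker ((U - u₁ • 1) * (U * U - 1))) := by
  have hmem : ∀ y, y ∈ LinearMap.ker (U - u₀ • (1 : Module.End R Y)) ↔ U y = u₀ • y := fun y => by
    simp [sub_eq_zero]
  refine IsCompl.of_eq ?_ ?_
  · rw [eq_bot_iff]
    rintro y ⟨h0, h1⟩
    have hfix := (projector_apply_eq_self_iff t p u₀ u₁ hu₀ hu₁ hunit d₁ dₚ U hU₁ hUₚ hAL c hc y).mpr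
      ((hmem y).mp h0)
    have hker : ((U - u₁ • 1) * (U * U - 1)) y = 0 := h1
    rw [Submodule.mem_bot, ← hfix, LinearMap.smul_apply, hker, smul_zero]
  · rw [eq_top_iff]
    rintro y -
    refine Submodule.mem_sup.mpr ⟨(c • ((U - u₁ • 1) * (U * U - 1))) y, ?_,
      y - (c • ((U - u₁ • 1) * (U * U - 1))) y, ?_, add_sub_cancel _ _⟩
    · exact (hmem _).mpr (U_projector_apply t p u₀ u₁ hu₀ hu₁ hunit d₁ dₚ U hU₁ hUₚ hAL c y)
    · exact cubic_apply_sub_projector t p u₀ u₁ hu₀ hu₁ hunit d₁ dₚ U hU₁ hUₚ hAL c hc y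

/-- **Checkpoint (i) (REFEREE 2 R2-155.3) WITHOUT NAKAYAMA: the `U_p`-nilpotent part lies in the
`p`-old part.** If `U y = u₀ • y` then `(U² − 1) y = (u₀² − 1) • y ∈ range j′` by `hAL`, and `u₀² − 1`
is a unit (`u₀ ∈ 𝔪`), so `y ∈ range j′`. No finiteness of `Y`, no Jacobson radical. [cite: Wiles1995, §2] -/
theorem ker_sub_le_range_coprod (u₀ : R) (hu₀1 : IsUnit (u₀ * u₀ - 1)) (d₁ dₚ : K →ₗ[R] Y)
    (U : Y →ₗ[R] Y) (hAL : ∀ y, U (U y) - y ∈ LinearMap.range (d₁.coprod dₚ)) :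
    LinearMap.ker (U - u₀ • 1) ≤ LinearMap.range (d₁.coprod dₚ) := by
  intro y hy
  have hUy : U y = u₀ • y := by
    simpa [sub_eq_zero] using hy
  have h1 : U (U y) - y = (u₀ * u₀ - 1) • y := by
    rw [hUy, map_smul, hUy, smul_smul, sub_smul, one_smul]
  obtain ⟨v, hv⟩ := hu₀1
  have h2 : y = v.inv • (U (U y) - y) := by
    rw [h1, smul_smul, ← hv, Units.inv_eq_val_inv, Units.inv_mul, one_smul]
  rw [h2]
  exact Submodule.smul_mem _ _ (hAL y)

end Annihilator

end Summit.BirchSwinnertonDyer.Rank1Residual.LevelLowering
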